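import Literature.AnabelianGeometry.SemiGraphs.TemperedAnchoredCompactOfAbelianEdges
import Literature.AnabelianGeometry.SemiGraphs.TemperedEdgeLikeIsInfVerticialHolds
import Literature.AnabelianGeometry.SemiGraphs.TemperedVerticialDistinctSameVertex
import HarnessLib

/-!
# [SemiAnbd] Thm 3.7 (iv) at every countable graph WITHOUT CORE with COMMUTATIVE edge groups: verticial ⇒
# maximal compact, and (iv) for ANCHORED subgroups (proof-only)

Mochizuki, *Semi-graphs of anabelioids*, Publ. RIMS **42** (2006), §3, Theorem 3.7 (iv) p. 41
[cite: MochizukiSemiAnbd2006, Thm 3.7(iv) p.41]: "the maximal compact subgroups of `π₁^temp(𝒢)` are precisely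
the verticial subgroups of `π₁^temp(𝒢)`; the nontrivial intersections of two distinct maximal compact subgroups
are precisely the edge-like subgroups [of closed edges]".

PROOF-ONLY file (abc-iut cell, layer L3, row «ANCHORED@STAR», seat abc-iut-w6-d064 gen 7; no definition).  The
port of abc-iut-w6-d062's `TemperedMaximalCompactAnchoredOfLocallyFinite.lean` from «locally finite» to the class
«no infinitely-branching core ∧ commutative edge groups» (which contains every locally finite graph with commutative
edge groups, the rayless star `𝒢⋆(p)` of infinite valence, and every countable graph without core whose edge groups
are `Ẑ(1)^{(Σ)}`): the arguments are w6-d062's VERBATIM, with this seat's anchored existence theorem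
`exists_verticial_ge_of_inf_verticial_ne_bot_of_noCore_of_commEdges` (`TemperedAnchoredCompactOfAbelianEdges.lean`,
no local finiteness, no level-estrangement) in place of the locally finite one, abc-iut-f-176's
`compactInTwoVerticial_of_noCore` in place of `compactInTwoVerticial_of_isLocallyFinite`, Thm 3.7 (ii)
(`verticialDistinct_holds`, `eq_of_le_of_mem_verticialSubgroups`) and abc-iut-f-173's `edgeLikeIsInfVerticialAt_holds`:

* `isMaximalCompactSubgroup_of_mem_verticialSubgroups_of_noCore_of_commEdges` — EVERY verticial subgroup is a
  maximal compact subgroup (the «⇐» half of the first sentence of (iv), unconditional in the class; at `𝒢⋆(p)`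
  this is the statement of abc-iut-L3-t8 gen 7's row «T37iv-VERT⇒MAXCPT@RAYLESS-STAR», whose star instance is
  left to that row);
* `isMaximalCompactSubgroup_iff_mem_verticialSubgroups_of_anchored_of_noCore_of_commEdges` — for ANCHORED `K`
  (`K ⊓ H₀ ≠ 1` for some verticial `H₀`): maximal compact ⇔ verticial;
* `exists_maximalCompact_inf_eq_of_mem_edgeLikeSubgroups_of_noCore_of_commEdges` — every nontrivial edge-like
  subgroup of a closed edge IS the intersection of two distinct maximal compact subgroups (unconditional);
* `exists_mem_edgeLikeSubgroups_of_maximalCompact_inf_of_anchored_of_noCore_of_commEdges` — conversely for an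
  intersection `K₁ ⊓ K₂ ≠ 1` of two distinct maximal compact subgroups ONE OF WHICH IS ANCHORED.

So in this class the whole of Thm 3.7 (iii)–(iv) holds away from ANCHOR-FREE compact subgroups (which exist at
`𝒢_θ` and at `𝒢⋆(p)`); nothing is asserted for those; nothing bears on [IUTchIII] Cor. 3.12; typed ≠ proved.
-/

namespace Literature.AnabelianGeometry.SemiGraphs

namespace ProfiniteSemiGraph

open Topology

universe u

variable (𝒢 : ProfiniteSemiGraph.{u})

/-- **Thm 3.7 (iv), «verticial ⇒ maximal compact», at every countable `𝒢` without core with commutative edge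
groups, every chart**: a verticial subgroup `H` is compact, and a compact `K ⊇ H` equals `H` — if `H ≠ 1`, `K` is
anchored at `H`, so lies in a verticial `H' ⊇ H` (`exists_verticial_ge_of_inf_verticial_ne_bot_of_noCore_of_commEdges`),
and `H = H'` by Thm 3.7 (ii) (`eq_of_le_of_mem_verticialSubgroups`); if `H = 1`, Thm 3.7 (ii) (second clause of
`VerticialDistinct`) forces `π₁^temp(𝒢) = 1` (abc-iut-w6-d062's argument verbatim).
[cite: MochizukiSemiAnbd2006, Thm 3.7(iv) p.41] -/
theorem isMaximalCompactSubgroup_of_mem_verticialSubgroups_of_noCore_of_commEdges (h37 : 𝒢.Thm37Hypotheses)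
    (hNC : ∀ S : Set 𝒢.graph.Vertex, S.Nonempty → ∃ w ∈ S,
      {b : 𝒢.graph.Branch | 𝒢.graph.abuts b = some w ∧ ∃ b', b' ≠ b ∧ 𝒢.graph.edgeOf b' = 𝒢.graph.edgeOf b ∧
        ∃ w' ∈ S, 𝒢.graph.abuts b' = some w'}.Finite)
    (hab : ∀ (e : 𝒢.graph.Edge) (k k' : 𝒢.Ge e), k * k' = k' * k)
    (c : TemperedPiChart 𝒢) {v : 𝒢.graph.Vertex} {H : Subgroup c.G}
    (hH : H ∈ verticialSubgroups c v) : IsMaximalCompactSubgroup H := by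
  refine ⟨isCompact_of_mem_verticialSubgroups c hH, fun K hKc hHK => ?_⟩
  by_cases hbot : H = ⊥
  · -- `π₁^temp(𝒢)` is trivial
    refine le_antisymm (fun g hg => ?_) hHK
    by_contra hgH
    obtain ⟨-, h2⟩ := verticialDistinct_holds 𝒢 h37 c
    have h0 := h2 v H hH 1 g (by simpa using hgH)
    subst hbot
    simp at h0
  · obtain ⟨v', H', hH', hKH'⟩ := exists_verticial_ge_of_inf_verticial_ne_bot_of_noCore_of_commEdges h37 hNC hab
      c K hKc hH (by rwa [inf_eq_right.mpr hHK])
    have hHH' : H = H' :=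
      eq_of_le_of_mem_verticialSubgroups verticialDistinct_holds h37 c hH hH' (hHK.trans hKH')
    subst hHH'
    exact le_antisymm hKH' hHK

/-- **Thm 3.7 (iv), first sentence, for ANCHORED subgroups** (no core, commutative edge groups, every chart): a
subgroup `K` meeting some verticial subgroup non-trivially is maximal compact iff it is verticial.
[cite: MochizukiSemiAnbd2006, Thm 3.7(iv) p.41] -/
theorem isMaximalCompactSubgroup_iff_mem_verticialSubgroups_of_anchored_of_noCore_of_commEdges
    (h37 : 𝒢.Thm37Hypotheses)
    (hNC : ∀ S : Set 𝒢.graph.Vertex, S.Nonempty → ∃ w ∈ S,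
      {b : 𝒢.graph.Branch | 𝒢.graph.abuts b = some w ∧ ∃ b', b' ≠ b ∧ 𝒢.graph.edgeOf b' = 𝒢.graph.edgeOf b ∧
        ∃ w' ∈ S, 𝒢.graph.abuts b' = some w'}.Finite)
    (hab : ∀ (e : 𝒢.graph.Edge) (k k' : 𝒢.Ge e), k * k' = k' * k)
    (c : TemperedPiChart 𝒢) (K : Subgroup c.G)
    {v₀ : 𝒢.graph.Vertex} {H₀ : Subgroup c.G} (hH₀ : H₀ ∈ verticialSubgroups c v₀) (hanch : K ⊓ H₀ ≠ ⊥) :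
    IsMaximalCompactSubgroup K ↔ ∃ v : 𝒢.graph.Vertex, K ∈ verticialSubgroups c v :=
  ⟨fun hK => exists_mem_verticialSubgroups_of_isMaximalCompactSubgroup_of_noCore_of_commEdges h37 hNC hab c K
      hK hH₀ hanch,
    fun ⟨_, hK⟩ => 𝒢.isMaximalCompactSubgroup_of_mem_verticialSubgroups_of_noCore_of_commEdges h37 hNC hab c hK⟩

/-- **Thm 3.7 (iv), second sentence «⇐», at every countable `𝒢` without core with commutative edge groups, every
chart** (unconditional): a nontrivial edge-like subgroup of a CLOSED edge is the intersection of two DISTINCT maximal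
compact subgroups (abc-iut-f-173's `edgeLikeIsInfVerticialAt_holds`: it is `H₁ ⊓ H₂` for distinct verticial `H₁`,
`H₂`, which are maximal compact by the first theorem). [cite: MochizukiSemiAnbd2006, Thm 3.7(iv) p.41] -/
theorem exists_maximalCompact_inf_eq_of_mem_edgeLikeSubgroups_of_noCore_of_commEdges (h37 : 𝒢.Thm37Hypotheses)
    (hNC : ∀ S : Set 𝒢.graph.Vertex, S.Nonempty → ∃ w ∈ S,
      {b : 𝒢.graph.Branch | 𝒢.graph.abuts b = some w ∧ ∃ b', b' ≠ b ∧ 𝒢.graph.edgeOf b' = 𝒢.graph.edgeOf b ∧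
        ∃ w' ∈ S, 𝒢.graph.abuts b' = some w'}.Finite)
    (hab : ∀ (e : 𝒢.graph.Edge) (k k' : 𝒢.Ge e), k * k' = k' * k)
    (c : TemperedPiChart 𝒢) {e : 𝒢.graph.Edge} (he : 𝒢.graph.IsClosedEdge e)
    {L : Subgroup c.G} (hL : L ∈ edgeLikeSubgroups c e) (hLne : L ≠ ⊥) :
    ∃ K₁ K₂ : Subgroup c.G, IsMaximalCompactSubgroup K₁ ∧ IsMaximalCompactSubgroup K₂ ∧ K₁ ≠ K₂ ∧
      L = K₁ ⊓ K₂ := by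
  obtain ⟨v₁, v₂, H₁, H₂, hH₁, hH₂, hne, rfl⟩ := edgeLikeIsInfVerticialAt_holds 𝒢 h37 c e he L hL hLne
  exact ⟨H₁, H₂, 𝒢.isMaximalCompactSubgroup_of_mem_verticialSubgroups_of_noCore_of_commEdges h37 hNC hab c hH₁,
    𝒢.isMaximalCompactSubgroup_of_mem_verticialSubgroups_of_noCore_of_commEdges h37 hNC hab c hH₂, hne, rfl⟩

/-- **Thm 3.7 (iv), second sentence «⇒», for an ANCHORED pair** (no core, commutative edge groups, every chart): a
nontrivial intersection `K₁ ⊓ K₂` of two distinct maximal compact subgroups, one of which meets some verticial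
subgroup non-trivially, is an edge-like subgroup of a closed edge.  (`K₁` is verticial; `K₂` is anchored at `K₁`,
hence verticial; `K₁ ⊓ K₂` is compact and lies in two distinct verticial subgroups, so — sentences 2–3 of (iii),
abc-iut-f-176's `compactInTwoVerticial_of_noCore` — in an edge-like `L'` of a closed edge, and `L' = H₁ ⊓ H₂`
(f-173) with `{H₁, H₂} = {K₁, K₂}`; w6-d062's argument verbatim.) [cite: MochizukiSemiAnbd2006, Thm 3.7(iv) p.41] -/
theorem exists_mem_edgeLikeSubgroups_of_maximalCompact_inf_of_anchored_of_noCore_of_commEdges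
    (h37 : 𝒢.Thm37Hypotheses)
    (hNC : ∀ S : Set 𝒢.graph.Vertex, S.Nonempty → ∃ w ∈ S,
      {b : 𝒢.graph.Branch | 𝒢.graph.abuts b = some w ∧ ∃ b', b' ≠ b ∧ 𝒢.graph.edgeOf b' = 𝒢.graph.edgeOf b ∧
        ∃ w' ∈ S, 𝒢.graph.abuts b' = some w'}.Finite)
    (hab : ∀ (e : 𝒢.graph.Edge) (k k' : 𝒢.Ge e), k * k' = k' * k)
    (c : TemperedPiChart 𝒢)
    {K₁ K₂ : Subgroup c.G} (hK₁ : IsMaximalCompactSubgroup K₁) (hK₂ : IsMaximalCompactSubgroup K₂)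
    (hne : K₁ ≠ K₂) (hL : K₁ ⊓ K₂ ≠ ⊥)
    {v₀ : 𝒢.graph.Vertex} {H₀ : Subgroup c.G} (hH₀ : H₀ ∈ verticialSubgroups c v₀) (hanch : K₁ ⊓ H₀ ≠ ⊥) :
    ∃ e : 𝒢.graph.Edge, 𝒢.graph.IsClosedEdge e ∧ K₁ ⊓ K₂ ∈ edgeLikeSubgroups c e := by
  obtain ⟨v₁, hK₁v⟩ :=
    exists_mem_verticialSubgroups_of_isMaximalCompactSubgroup_of_noCore_of_commEdges h37 hNC hab c K₁ hK₁ hH₀ hanch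
  obtain ⟨v₂, hK₂v⟩ :=
    exists_mem_verticialSubgroups_of_isMaximalCompactSubgroup_of_noCore_of_commEdges h37 hNC hab c K₂ hK₂ hK₁v
      (by rwa [inf_comm])
  haveI := c.t2Space
  have hLc : IsCompact ((K₁ ⊓ K₂ : Subgroup c.G) : Set c.G) := by
    rw [Subgroup.coe_inf]
    exact hK₁.1.inter_right hK₂.1.isClosed
  obtain ⟨honly, e, L', he, hL', hLL'⟩ := 𝒢.compactInTwoVerticial_of_noCore h37 hNC c (K₁ ⊓ K₂)
    hLc hL hK₁v hK₂v hne inf_le_left inf_le_right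
  have hL'ne : L' ≠ ⊥ := fun h => hL (le_bot_iff.mp (h ▸ hLL'))
  obtain ⟨w₁, w₂, H₁, H₂, hH₁, hH₂, hH, rfl⟩ := edgeLikeIsInfVerticialAt_holds 𝒢 h37 c e he L' hL' hL'ne
  have hH₁' := honly w₁ H₁ hH₁ (hLL'.trans inf_le_left)
  have hH₂' := honly w₂ H₂ hH₂ (hLL'.trans inf_le_right)
  refine ⟨e, he, ?_⟩
  rcases hH₁' with rfl | rfl <;> rcases hH₂' with rfl | rfl
  · exact absurd rfl hH
  · exact hL'
  · rw [inf_comm]; exact hL'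
  · exact absurd rfl hH

/-- **Maximal compact subgroups in the class, DICHOTOMY** (no core, commutative edge groups, every chart): a maximal
compact subgroup of `π₁^temp(𝒢)` is EITHER a verticial subgroup OR anchor-free (meets every verticial subgroup
trivially) — the only possible non-verticial maximal compact subgroups are the «exotic» anchor-free ones (such as
the escaping `⟨c⟩‾` at `𝒢_θ`, abc-iut-w6-d063). [cite: MochizukiSemiAnbd2006, Thm 3.7(iv) p.41] -/
theorem mem_verticialSubgroups_or_anchorFree_of_isMaximalCompactSubgroup_of_noCore_of_commEdges
    (h37 : 𝒢.Thm37Hypotheses)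
    (hNC : ∀ S : Set 𝒢.graph.Vertex, S.Nonempty → ∃ w ∈ S,
      {b : 𝒢.graph.Branch | 𝒢.graph.abuts b = some w ∧ ∃ b', b' ≠ b ∧ 𝒢.graph.edgeOf b' = 𝒢.graph.edgeOf b ∧
        ∃ w' ∈ S, 𝒢.graph.abuts b' = some w'}.Finite)
    (hab : ∀ (e : 𝒢.graph.Edge) (k k' : 𝒢.Ge e), k * k' = k' * k)
    (c : TemperedPiChart 𝒢) (K : Subgroup c.G) (hK : IsMaximalCompactSubgroup K) :
    (∃ v : 𝒢.graph.Vertex, K ∈ verticialSubgroups c v) ∨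
      ∀ (v : 𝒢.graph.Vertex) (H : Subgroup c.G), H ∈ verticialSubgroups c v → K ⊓ H = ⊥ := by
  by_cases h : ∀ (v : 𝒢.graph.Vertex) (H : Subgroup c.G), H ∈ verticialSubgroups c v → K ⊓ H = ⊥
  · exact Or.inr h
  · push Not at h
    obtain ⟨v₀, H₀, hH₀, hanch⟩ := h
    exact Or.inl (exists_mem_verticialSubgroups_of_isMaximalCompactSubgroup_of_noCore_of_commEdges h37 hNC hab c
      K hK hH₀ hanch)

end ProfiniteSemiGraph

end Literature.AnabelianGeometry.SemiGraphs
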